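import Mathlib
import Literature.MathematicalPhysics.QuantumFieldTheory.Balaban1983to89.B12Average012Analytic
import Literature.MathematicalPhysics.QuantumFieldTheory.Balaban1983to89.B12Average012Prop2

/-!
# `Balaban1983to89.B12Average012AnalyticIter` — [Balaban1987RG1] (0.12), (2.4), p. 267 / [Balaban1985Averaging]
# Props 3–4 (analyticity clauses): `Q̃_V` is complex-analytic at `0` on the Banach space of fields on finitely many
# bonds, its Fréchet derivative there is the linear part `LQ̃`, the remainder `C̃(B′) = Q̃_V(B′) − LQ̃B′` is
# `O(‖B′‖²)` («Taylor's expansion begins with a second-order polynomial»), and every level `Ū^j`, `j ≤ k`, of the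
# `k`-fold average is analytic in the configuration on the domain of Proposition 2 — PROVED for [I]'s actual average

HONEST FRAMING (cell `lit-balaban`, verbatim): statement-level skeleton of published theorems with citation tags;
proofs where landed; nothing here is a claim about the Yang–Mills mass gap.

CITATION HEADER.  T. Bałaban, *Renormalization group approach to lattice gauge field theories. I*, Commun. Math.
Phys. **109** (1987) 249–301, doi:10.1007/bf01215223 [Balaban1987RG1] (cell paper B12 = «[I]»), (0.12) p. 254 and
«all results of the paper [12] are valid for it» (re-read from the held text `paper:balaban1987-cmp109-rg-i-small-field`).
[12] = [B7] = [Balaban1985Averaging], Commun. Math. Phys. **98** (1985) 17–51, Proposition 4 p. 38: «the function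
Q_k(U₀, ηA, c) = (1/i) log(Ū₁^k)_c, c ⊂ Ω^{(k)}, is an analytic function of the variables A_b, b ⊂ B^k(c₋) ∪
B^k(c₊)» (tree leaf `B7.Prop4Printed`, field `IsAnalyticQk`), and Proposition 2 (52)–(54) p. 26 (the domain).  Unit
`lit-balaban-r09` gen 9 (display owner of CMP 109; TAKING line `HOME/STATUS.md` 2026-08-21T09:3xZ), HOME
`run/shared/lean/pub/lit-balaban/`; SKELETON rows `B12.Eq0.12`, `B12.Eq2.4` (cells only).

DICTIONARY print → Lean (all PRE-EXISTING).  As `B12Average012Analytic` (analytic families `U : E → (ZdEdge d →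
𝔸ˣ)`), `Ū^j` ↦ `B12Average012Prop2.avgIter012`, (52)'s functional ↦ `pdevZ`, `C₀` ↦ `C0A d`, `c₂′` ↦
`B7Prop2Explicit.c2' d L`, `G = U(𝔸)` ↦ `B7Prop2Explicit.unitaryUnits` (C⋆-algebra `𝔸`).

THE ARGUMENT FORMALISED.  § 1: `B12Average012Analytic.analyticAt_Qtilde` on the parameter space `E = (S → 𝔸)` with
the coordinate fields `B ↦ B_b` (continuous linear, hence analytic) and `0` off `S`.  § 2: induction on `j ≤ k`: `Ū^{j+1}_{U_t} = \overline{Ū^j_{U_t}}` with `t ↦ Ū^j_{U_t}` an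
analytic family (induction hypothesis) whose member at `t₀` is unitary and `ε`-regular, `ε = sup_p‖Ū^j(∂p) − 1‖ <
2α₀` by (54) at level `j` (`B12Average012Prop2.prop2_012`, `prop2_012_lt_two` with `k := j`), so `(dL)²ε < 1/100` and
the one-step analyticity `B12Average012Analytic.analyticAt_avgBar` applies.  Specialisation to the line `t ↦
exp(itB′)V` through a unitary regular `V` (`analyticAt_avgIter012_pert`).

WHAT IS PROVED (kernel-checked, no `sorry`, axioms `propext`, `Classical.choice`, `Quot.sound`; NO definition, NO
`Prop` placeholder, net new unproved facts 0): **`analyticAt_Qtilde_fields`** (§ 1: `Q̃_V` is complex-analytic at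
`0` on the Banach space `S → 𝔸` of fields on any finite bond set `S`, extended by `0` — the germ form of Prop. 3's
«analytic function of the variables A_b, b ⊂ B(c₋) ∪ B(c₊)» for [I]'s actual average), **`fderiv_Qtilde_fields_apply`**
(its Fréchet derivative at `0` applied to `B′` is the tree's `LQ̃B′`), **`Ctilde_isBigO`** (`Q̃_V(B′)(c) − LQ̃B′(c) =
O(‖B′‖²)` as `B′ → 0` — [B7] p. 36 «C(V₀, A, c) … Taylor's expansion begins with a second-order polynomial» in germ
form, from Mathlib's `HasFPowerSeriesAt.isBigO_sub_partialSum_pow`), **`analyticAt_avgIter012`**,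
`analyticAt_avgIter012_pert` (§ 2).

DIVERGENCES FROM PRINT / WHAT IS NOT PROVED (honest scope).  (a) As `B12Average012Analytic` (a)–(c): germ
analyticity at the configuration, no polydisc radius, no bound; the remainder statement is big-O at `0` WITHOUT
print's constant `C₁L²` of (123) nor (135)'s `C₂` (those need a quantitative polydisc and a sup bound, not done); before the logarithm
(`(1/i) log(Ū^k)_c(Ū₀^k)_c⁻¹` is one `MatrixLog.analyticAt_mlog` away wherever its argument is within `1` of `1`).
(b) Unitary configurations in a C⋆-algebra under the hypotheses of [B7] Prop. 2 (which keep every level in the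
domain of the one-step statement); print's `Gᶜ`-valued perturbations `U′ = e^{iηA′}` with complex `A′` (Prop. 7)
are covered only through the abstract analytic family `U_t` (any complex parameter space `E`), at a unitary centre.
-/

noncomputable section

open NormedSpace Finset Asymptotics

namespace Literature.MathematicalPhysics.QuantumFieldTheory.Balaban1983to89.B12Average012AnalyticIter

open _root_.Topology

open Literature.MathematicalPhysics.QuantumLattice (ZdEdge plaquetteHolonomyZd)
open B7Prop1Explicit (U1 mem_U1)
open B7Prop2Explicit (unitaryUnits mem_unitaryUnits unitaryUnits_le_U1 c2')
open B12SmallFieldRegion255 (avgBar)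
open B12Average012Prop2 (pdevZ pdevZ_nonneg le_pdevZ C0A avgIter012 avgIter012_zero avgIter012_succ prop2_012
  prop2_012_lt_two)
open B12Average012Analytic (analyticAt_avgBar)

variable {d : ℕ}
variable {E : Type*} [NormedAddCommGroup E] [NormedSpace ℂ E]

/-! ## § 1  `Q̃_V` as an analytic function on the Banach space of fields on finitely many bonds -/

section Fields

variable {𝔸 : Type*} [NormedRing 𝔸] [NormedAlgebra ℂ 𝔸] [NormOneClass 𝔸] [CompleteSpace 𝔸] {L : ℕ}

/-- [cite: Balaban1987RG1, (2.4) p.266][cite: Balaban1985Averaging, Prop.3 (121) p.36] **`Q̃_V` IS COMPLEX-ANALYTIC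
AT `0` ON THE BANACH SPACE OF FIELDS `B′` ON ANY FINITE SET OF BONDS `S`** (extended by `0` off `S`; by locality the
relevant `S` is `{b ⊂ B(c₋) ∪ B(c₊)}` = `B7BlockGeometry.qppBonds L c`, print's «analytic function of the variables
A_b, b ⊂ B(c₋) ∪ B(c₊)»): the germ of `B12Average012Analytic.analyticAt_Qtilde` on the parameter space `S → 𝔸`
with the coordinate fields, i.e. a power series in `B′|_S` converging on a ball of positive radius (radius not
estimated), at every `U1`-valued `ε₀`-regular `V` with `(dL)²ε₀ < 1/100`, `d ≥ 1`. -/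
theorem analyticAt_Qtilde_fields (hL : 0 < L) (hd : 1 ≤ d) (V : ZdEdge d → 𝔸ˣ) (hV : ∀ b, V b ∈ U1 𝔸) {ε₀ : ℝ}
    (hε₀ : 0 ≤ ε₀) (hsm : ((d : ℝ) * L) ^ 2 * ε₀ < 1 / 100)
    (h44 : ∀ (p : Fin d → ℤ) (i j : Fin d), i ≠ j → ‖((plaquetteHolonomyZd V p i j : 𝔸ˣ) : 𝔸) - 1‖ ≤ ε₀)
    (S : Finset (ZdEdge d)) (c : ZdEdge d) :
    AnalyticAt ℂ (fun B : (S → 𝔸) =>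
      B12AverageCorridor267.Qtilde L (fun U : ZdEdge d → 𝔸ˣ => B12ContourAverage253.Tavg L U) V
        (fun b => if h : b ∈ S then B ⟨b, h⟩ else 0) c) 0 := by
  refine B12Average012Analytic.analyticAt_Qtilde (E := S → 𝔸) (fun (B : S → 𝔸) b => if h : b ∈ S then B ⟨b, h⟩ else 0)
    (fun b => ?_) ?_ hL hd V hV hε₀ hsm h44 c
  · by_cases h : b ∈ S
    · simp only [dif_pos h]
      exact (ContinuousLinearMap.proj (R := ℂ) (φ := fun _ : S => 𝔸) (⟨b, h⟩ : S)).analyticAt 0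
    · simp only [dif_neg h]
      exact analyticAt_const
  · funext b
    by_cases h : b ∈ S
    · simp only [dif_pos h, Pi.zero_apply]
    · simp only [dif_neg h, Pi.zero_apply]

/-- [cite: Balaban1987RG1, p.267] on the field space `S → 𝔸` the Fréchet derivative of `Q̃_V` at `0` applied to `B′`
IS the tree's linear part `LQ̃B′` (`B12AverageCorridor267.LQ`, defined as the derivative along the line `s ↦ sB′`). -/
theorem fderiv_Qtilde_fields_apply (hL : 0 < L) (hd : 1 ≤ d) (V : ZdEdge d → 𝔸ˣ) (hV : ∀ b, V b ∈ U1 𝔸) {ε₀ : ℝ}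
    (hε₀ : 0 ≤ ε₀) (hsm : ((d : ℝ) * L) ^ 2 * ε₀ < 1 / 100)
    (h44 : ∀ (p : Fin d → ℤ) (i j : Fin d), i ≠ j → ‖((plaquetteHolonomyZd V p i j : 𝔸ˣ) : 𝔸) - 1‖ ≤ ε₀)
    (S : Finset (ZdEdge d)) (c : ZdEdge d) (B : S → 𝔸) :
    fderiv ℂ (fun B : (S → 𝔸) =>
        B12AverageCorridor267.Qtilde L (fun U : ZdEdge d → 𝔸ˣ => B12ContourAverage253.Tavg L U) V
          (fun b => if h : b ∈ S then B ⟨b, h⟩ else 0) c) 0 B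
      = B12AverageCorridor267.LQ L (fun U : ZdEdge d → 𝔸ˣ => B12ContourAverage253.Tavg L U) V
          (fun b => if h : b ∈ S then B ⟨b, h⟩ else 0) c := by
  set f : (S → 𝔸) → 𝔸 := fun B =>
    B12AverageCorridor267.Qtilde L (fun U : ZdEdge d → 𝔸ˣ => B12ContourAverage253.Tavg L U) V
      (fun b => if h : b ∈ S then B ⟨b, h⟩ else 0) c with hf
  have hfd : HasFDerivAt f (fderiv ℂ f 0) 0 :=
    (analyticAt_Qtilde_fields hL hd V hV hε₀ hsm h44 S c).differentiableAt.hasFDerivAt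
  have hγ : HasDerivAt (fun s : ℂ => s • B) B 0 := by
    simpa using (hasDerivAt_id (0 : ℂ)).smul_const B
  have h0 : (fun s : ℂ => s • B) 0 = 0 := by simp
  have hfd' : HasFDerivAt f (fderiv ℂ f 0) ((fun s : ℂ => s • B) 0) := by rw [h0]; exact hfd
  have hc : HasDerivAt (f ∘ fun s : ℂ => s • B) (fderiv ℂ f 0 B) 0 := hfd'.comp_hasDerivAt (0 : ℂ) hγ
  have e' : (fun s : ℂ => B12AverageCorridor267.Qtilde L (fun U : ZdEdge d → 𝔸ˣ => B12ContourAverage253.Tavg L U) V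
      (s • fun b => if h : b ∈ S then B ⟨b, h⟩ else 0) c) = f ∘ fun s : ℂ => s • B := by
    funext s
    simp only [hf, Function.comp_apply]
    congr 1
    funext b
    by_cases h : b ∈ S
    · simp only [Pi.smul_apply, dif_pos h]
    · simp only [Pi.smul_apply, dif_neg h, smul_zero]
  unfold B12AverageCorridor267.LQ
  rw [e', hc.deriv]

/-- [cite: Balaban1987RG1, p.267][cite: Balaban1985Averaging, Prop.3 (122)–(123) p.36] **THE REMAINDER `C̃(B′) = Q̃_V(B′)
− LQ̃B′` BEGINS WITH SECOND ORDER** for [I]'s actual (0.12)/(0.11) average: on the field space `S → 𝔸` (any finite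
bond set `S`, fields extended by `0`), `Q̃_V(B′)(c) − LQ̃B′(c) = O(‖B′‖²)` as `B′ → 0` — [B7] p. 36 «C(V₀, A, c) is an
analytic function of A whose Taylor's expansion begins with a second-order polynomial» for the actual average, in
germ (big-O) form: the power series of § 1 at `0` has constant term `Q̃_V(0) = 0` and linear term `LQ̃`. -/
theorem Ctilde_isBigO (hL : 0 < L) (hd : 1 ≤ d) (V : ZdEdge d → 𝔸ˣ) (hV : ∀ b, V b ∈ U1 𝔸) {ε₀ : ℝ}
    (hε₀ : 0 ≤ ε₀) (hsm : ((d : ℝ) * L) ^ 2 * ε₀ < 1 / 100)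
    (h44 : ∀ (p : Fin d → ℤ) (i j : Fin d), i ≠ j → ‖((plaquetteHolonomyZd V p i j : 𝔸ˣ) : 𝔸) - 1‖ ≤ ε₀)
    (S : Finset (ZdEdge d)) (c : ZdEdge d) :
    (fun B : (S → 𝔸) =>
        B12AverageCorridor267.Qtilde L (fun U : ZdEdge d → 𝔸ˣ => B12ContourAverage253.Tavg L U) V
            (fun b => if h : b ∈ S then B ⟨b, h⟩ else 0) c
          - B12AverageCorridor267.LQ L (fun U : ZdEdge d → 𝔸ˣ => B12ContourAverage253.Tavg L U) V
            (fun b => if h : b ∈ S then B ⟨b, h⟩ else 0) c)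
      =O[𝓝 (0 : S → 𝔸)] fun B : (S → 𝔸) => ‖B‖ ^ 2 := by
  obtain ⟨p, hp⟩ := analyticAt_Qtilde_fields hL hd V hV hε₀ hsm h44 S c
  have hbig := hp.isBigO_sub_partialSum_pow 2
  -- `Q̃_V(0)(c) = 0`
  have hext0 : (fun b : ZdEdge d => if h : b ∈ S then (0 : S → 𝔸) ⟨b, h⟩ else 0) = 0 := by
    funext b
    by_cases h : b ∈ S
    · simp only [dif_pos h, Pi.zero_apply]
    · simp only [dif_neg h, Pi.zero_apply]
  have hQ0 : B12AverageCorridor267.Qtilde L (fun U : ZdEdge d → 𝔸ˣ => B12ContourAverage253.Tavg L U) V 0 c = 0 := by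
    unfold B12AverageCorridor267.Qtilde
    simp only [B12AverageCorridor267.pert_zero, mul_inv_cancel, Units.val_one, MatrixLog.mlog_one, smul_zero]
  -- the linear term of the power series is `LQ̃`
  have h1 : ∀ B : S → 𝔸, p 1 (fun _ : Fin 1 => B) = fderiv ℂ (fun B : (S → 𝔸) =>
      B12AverageCorridor267.Qtilde L (fun U : ZdEdge d → 𝔸ˣ => B12ContourAverage253.Tavg L U) V
        (fun b => if h : b ∈ S then B ⟨b, h⟩ else 0) c) 0 B := fun B => by
    rw [hp.fderiv_eq, continuousMultilinearCurryFin1_apply]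
    congr 1
  refine hbig.congr' (Filter.Eventually.of_forall fun B => ?_) Filter.EventuallyEq.rfl
  simp only [zero_add, FormalMultilinearSeries.partialSum, Finset.sum_range_succ, Finset.sum_range_zero]
  rw [hp.coeff_zero, h1 B, hext0, hQ0, zero_add, fderiv_Qtilde_fields_apply hL hd V hV hε₀ hsm h44 S c B]

end Fields

/-! ## § 2  All levels of the `k`-fold average are analytic on the domain of [B7] Proposition 2 -/

section Levels

variable {𝔸 : Type*} [CStarAlgebra 𝔸] [Nontrivial 𝔸] {L : ℕ}

/-- [cite: Balaban1987RG1, (0.12) p.254][cite: Balaban1985Averaging, Prop.4 p.38] **EVERY LEVEL `Ū^j`, `j ≤ k`, OF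
THE `k`-FOLD (0.12)/(0.11) AVERAGE IS AN ANALYTIC FUNCTION OF THE CONFIGURATION** on the domain of [B7] Proposition 2
(unitary configurations in a C⋆-algebra, (52) `sup_p‖U(∂p) − 1‖ < α₀η²`, `η = L^{−k}`, `C₀α₀ ≤ 1/3`, `2α₀ ≤ c₂′`,
`d ≥ 1`, `L ≥ 2`): for every analytic family `t ↦ U_t` with `U_{t₀} = U`, each bond variable `t ↦ Ū^j_{U_t}(c)` is
complex-analytic at `t₀` — the analyticity clause of [B7] Proposition 4 («Q_k(U₀, ηA, c) = (1/i) log(Ū₁^k)_c … is an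
analytic function of the variables A_b») for [I]'s actual average before the logarithm; induction on `j` with the
one-step `B12Average012Analytic.analyticAt_avgBar`, applicable at level `j` since `Ū^j` is unitary and `ε`-regular with
`(dL)²ε < (dL)²·2α₀ ≤ 1/512` by (54) at level `j`. -/
theorem analyticAt_avgIter012 (hL : 2 ≤ L) (hd : 1 ≤ d) (k : ℕ) (U : E → ZdEdge d → 𝔸ˣ) {t₀ : E}
    (hU : ∀ b, AnalyticAt ℂ (fun t => ((U t b : 𝔸ˣ) : 𝔸)) t₀) (hU0 : ∀ b, U t₀ b ∈ unitaryUnits 𝔸) {α₀ : ℝ}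
    (hα : 0 < α₀) (hα3 : C0A d * α₀ ≤ 1 / 3) (hα2 : 2 * α₀ ≤ c2' d L)
    (h52 : pdevZ (U t₀) < α₀ * (((L : ℝ) ^ k)⁻¹) ^ 2) :
    ∀ j ≤ k, ∀ c, AnalyticAt ℂ (fun t => ((avgIter012 L (U t) j c : 𝔸ˣ) : 𝔸)) t₀ := by
  have hL1 : 1 ≤ L := le_trans (by norm_num) hL
  have hL0 : 0 < L := hL1
  have hL1r : (1 : ℝ) ≤ L := by exact_mod_cast hL1
  -- `2α₀ ≤ c₂′` forces `(dL)²·2α₀ ≤ 1/512`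
  have hsm2 : ((d : ℝ) * L) ^ 2 * (2 * α₀) ≤ 1 / 512 := by
    have hpos : (0 : ℝ) < 512 * ((d : ℝ) + 1) * (d + 4) * (L : ℝ) ^ 2 := by positivity
    have h1 : 2 * α₀ ≤ 1 / (512 * ((d : ℝ) + 1) * (d + 4) * (L : ℝ) ^ 2) := hα2
    rw [le_div_iff₀ hpos] at h1
    have h2 : ((d : ℝ) * L) ^ 2 ≤ (d + 1) * (d + 4) * (L : ℝ) ^ 2 := by
      have : (d : ℝ) ^ 2 ≤ (d + 1) * (d + 4) := by nlinarith
      have hL2 : (0 : ℝ) ≤ (L : ℝ) ^ 2 := by positivity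
      nlinarith
    have h3 : 0 ≤ 2 * α₀ := by linarith
    nlinarith [mul_le_mul_of_nonneg_right h2 h3]
  have h52j : ∀ j ≤ k, pdevZ (U t₀) < α₀ * (((L : ℝ) ^ j)⁻¹) ^ 2 := by
    intro j hj
    refine h52.trans_le (mul_le_mul_of_nonneg_left ?_ hα.le)
    have hjk : (L : ℝ) ^ j ≤ (L : ℝ) ^ k := pow_le_pow_right₀ hL1r hj
    have hj0 : (0 : ℝ) < (L : ℝ) ^ j := by positivity
    gcongr
  intro j
  induction j with
  | zero =>
      intro _ c
      simp only [avgIter012_zero]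
      exact hU c
  | succ j ih =>
      intro hjk c
      have hjk' : j ≤ k := Nat.le_of_succ_le hjk
      have hmem := (prop2_012 hL hd j (U t₀) hU0 hα hα3 hα2 (h52j j hjk')).2 j le_rfl
      have hU1j : ∀ b, avgIter012 L (U t₀) j b ∈ U1 𝔸 := fun b => unitaryUnits_le_U1 (hmem b)
      have hlt : pdevZ (avgIter012 L (U t₀) j) < 2 * α₀ :=
        prop2_012_lt_two hL hd j (U t₀) hU0 hα hα3 hα2 (h52j j hjk')
      set ε : ℝ := pdevZ (avgIter012 L (U t₀) j) with hε
      have hε0 : 0 ≤ ε := pdevZ_nonneg _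
      have hdl : 0 ≤ ((d : ℝ) * L) ^ 2 := by positivity
      have hsm : ((d : ℝ) * L) ^ 2 * ε < 1 / 100 := by
        have := mul_le_mul_of_nonneg_left hlt.le hdl
        linarith
      have h44 : ∀ (x : Fin d → ℤ) (i i' : Fin d), i ≠ i' →
          ‖((plaquetteHolonomyZd (avgIter012 L (U t₀) j) x i i' : 𝔸ˣ) : 𝔸) - 1‖ ≤ ε :=
        fun x i i' _ => le_pdevZ hU1j x i i'
      simp only [avgIter012_succ]
      exact analyticAt_avgBar (fun t => avgIter012 L (U t) j) (fun b => ih hjk' b) hL0 hd hU1j hε0 hsm h44 c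

/-- [cite: Balaban1987RG1, (0.12) p.254][cite: Balaban1985Averaging, Prop.4 p.38] in particular for the linear
family `t ↦ V′_tV`, `V′_t = exp(itB′)` through a unitary `V` on the domain of Proposition 2: every `Ū^j(V′_tV)(c)`,
`j ≤ k`, is analytic in `t ∈ ℂ` at `t = 0`. -/
theorem analyticAt_avgIter012_pert (hL : 2 ≤ L) (hd : 1 ≤ d) (k : ℕ) (V : ZdEdge d → 𝔸ˣ)
    (hV : ∀ b, V b ∈ unitaryUnits 𝔸) (B' : ZdEdge d → 𝔸) {α₀ : ℝ} (hα : 0 < α₀) (hα3 : C0A d * α₀ ≤ 1 / 3)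
    (hα2 : 2 * α₀ ≤ c2' d L) (h52 : pdevZ V < α₀ * (((L : ℝ) ^ k)⁻¹) ^ 2) :
    ∀ j ≤ k, ∀ c, AnalyticAt ℂ
      (fun t : ℂ => ((avgIter012 L (B12AverageCorridor267.pert (t • B') V) j c : 𝔸ˣ) : 𝔸)) 0 := by
  have hU : ∀ b, AnalyticAt ℂ (fun t : ℂ => ((B12AverageCorridor267.pert (t • B') V b : 𝔸ˣ) : 𝔸)) 0 :=
    B12Average012Analytic.analyticAt_pert (fun t : ℂ => t • B') (fun b => analyticAt_id.smul analyticAt_const) V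
  have h0 : B12AverageCorridor267.pert ((0 : ℂ) • B') V = V := by rw [zero_smul, B12AverageCorridor267.pert_zero]
  refine analyticAt_avgIter012 hL hd k (fun t : ℂ => B12AverageCorridor267.pert (t • B') V) hU ?_ hα hα3 hα2 ?_
  · intro b; rw [h0]; exact hV b
  · rw [h0]; exact h52

end Levels

end Literature.MathematicalPhysics.QuantumFieldTheory.Balaban1983to89.B12Average012AnalyticIter

end
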